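import Literature.MathematicalPhysics.QuantumLattice.SplitPairWickDeterminant
import HarnessLib

/-!
# The SHIFTED split-pair thermal Wick theorem: tadpole counterterms on the pair block

Topic `MathematicalPhysics/QuantumLattice`; continuation of `SplitPairWickDeterminant.lean` (`gibbsState_dGamma_splitPairWord_eq_neg_det`:
`⟨c(g₀)·(K pairs)·c†(f_K)·(pairs)⟩ = −det(splitPairMatrix)`).  In the renormalised perturbation series of the two-point Schwinger function
at unequal times (Benfatto–Giuliani–Mastropietro 2006 §2.1 (2.8), with the Hartree counterterm `ν` of §2), every interaction pair carries
the shift `a⁺a⁻ − ν`; as in `ShiftedWickDeterminant` (alternating words) the shifts land on the DIAGONAL of the fermionic determinant —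
here on the pair block only, the split external pair carrying none:

* `oneInsertionFactorShift` (the factors with pair shifts `d`), `oneInsertionFactorShift_zero`, `oneInsertionFactorShift_update`
  (the word is affine in each shift), `oneInsertionFactorShift_succAbove` (deleting a pair leaves the split-pair word of the remaining data,
  insertion point `m.predAbove K`);
* `splitPairMatrix_sub_diagonal_submatrix_succAbove` — deleting a pair from `splitPairMatrix − diagonal(0,d)` gives the same object for the
  remaining data (`Fin.succAbove_succAbove_succAbove_predAbove`);
* **`gibbsState_dGamma_splitPairWordShift_eq_neg_det`** — `⟨c(g₀)·∏_i (factor_i − d·1)⟩_{β,dΓ(h)} = −det(splitPairMatrix − diagonal (0, d))`,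
  by induction on the number of pairs, one shift at a time (both sides affine in each `d_m`, slopes = deleted word / principal minor);
* `gibbsState_dGamma_splitPairBlockWordShift_eq_neg_det` — the BLOCK FORM `⟨c(g_Y)·∏_{m<K}(pair − d₁m)·c†(f_X)·∏_{l<J}(pair − d₂l)⟩ =
  −det(splitPairMatrix … (Fin.append f₁ (f_X, f₂)) (g_Y, Fin.append g₁ g₂) − diagonal (0, Fin.append d₁ d₂))` (the shape of the two-time
  Dyson coefficients of `ShiftedHubbardTwoTimeDyson`).

Everything is PROVED; one bookkeeping definition.

## References
* G. Benfatto, A. Giuliani, V. Mastropietro, Ann. Henri Poincaré 7 (2006) 809–898, §2, §2.1 (2.8). [BenfattoGiulianiMastropietro2006]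
* M. Gaudin, Nucl. Phys. 15 (1960) 89. [Gaudin1960]
-/

namespace Literature.MathematicalPhysics.QuantumLattice

open Matrix Finset

variable {ι : Type*} [LinearOrder ι] [Fintype ι]

/-! ### Shifts (tadpole counterterms) on the pair factors: one pair at a time -/

section ShiftLemmas

/-- Determinant with one diagonal entry shifted: `det (X with row j ↦ X_j − t e_j) = det X − t · det X^{(j,j)}`. [folklore] -/
private theorem det_updateRow_sub_smul_single {R : Type*} [CommRing R] {N : ℕ} (X : Matrix (Fin (N + 1)) (Fin (N + 1)) R)
    (j : Fin (N + 1)) (t : R) :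
    (X.updateRow j (X j - t • Pi.single j 1)).det = X.det - t * (X.submatrix j.succAbove j.succAbove).det := by
  have hL : (X.updateRow j (Pi.single j (1 : R))).det = (X.submatrix j.succAbove j.succAbove).det := by
    rw [Matrix.det_succ_row _ j, Finset.sum_eq_single j]
    · have hsub : (X.updateRow j (Pi.single j (1 : R))).submatrix j.succAbove j.succAbove =
          X.submatrix j.succAbove j.succAbove := by
        ext a b
        simp
      rw [hsub, Matrix.updateRow_self, Pi.single_eq_same, mul_one, ← two_mul, pow_mul, neg_one_sq, one_pow, one_mul]
    · intro b _ hb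
      rw [Matrix.updateRow_self, Pi.single_eq_of_ne' hb.symm, mul_zero, zero_mul]
    · intro h; exact absurd (Finset.mem_univ j) h
  rw [sub_eq_add_neg, ← neg_smul, Matrix.det_updateRow_add, Matrix.updateRow_eq_self, Matrix.det_updateRow_smul, hL]
  ring

variable {A : Type*} [Ring A] [Algebra ℂ A]

/-- Ordered product with one factor shifted by a central element: `∏ (… (y − t·1)_j …) = ∏ (… y_j …) − t · ∏_{i ≠ j} x_i`. [folklore] -/
private theorem listProd_ofFn_update_sub_smul :
    ∀ {N : ℕ} (x : Fin (N + 1) → A) (j : Fin (N + 1)) (y : A) (t : ℂ),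
      (List.ofFn (Function.update x j (y - t • (1 : A)))).prod =
        (List.ofFn (Function.update x j y)).prod - t • (List.ofFn (x ∘ j.succAbove)).prod
  | 0, x, j, y, t => by
    have hj : j = 0 := Fin.ext (Nat.lt_one_iff.mp j.isLt)
    subst hj
    rw [List.ofFn_succ (f := Function.update x 0 (y - t • (1 : A))), List.ofFn_succ (f := Function.update x 0 y),
      Function.update_self, Function.update_self]
    simp only [List.ofFn_zero, List.prod_cons, List.prod_nil, mul_one]
  | N + 1, x, j, y, t => by
    induction j using Fin.cases with
    | zero =>
      rw [List.ofFn_succ (f := Function.update x 0 (y - t • (1 : A))), List.ofFn_succ (f := Function.update x 0 y),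
        Function.update_self, Function.update_self]
      have htail : ∀ z : A, (fun i : Fin (N + 1) => Function.update x 0 z i.succ) = fun i => x i.succ := by
        intro z; funext i; rw [Function.update_of_ne (Fin.succ_ne_zero i)]
      rw [htail, htail, List.prod_cons, List.prod_cons, sub_mul, smul_mul_assoc, one_mul]
      rfl
    | succ j =>
      rw [List.ofFn_succ (f := Function.update x j.succ (y - t • (1 : A))), List.ofFn_succ (f := Function.update x j.succ y),
        Function.update_of_ne (Fin.succ_ne_zero j).symm, Function.update_of_ne (Fin.succ_ne_zero j).symm, List.prod_cons,
        List.prod_cons]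
      have htail : ∀ z : A, (fun i : Fin (N + 1) => Function.update x j.succ z i.succ) =
          Function.update (fun i : Fin (N + 1) => x i.succ) j z := by
        intro z; funext i
        by_cases hi : i = j
        · subst hi; rw [Function.update_self, Function.update_self]
        · rw [Function.update_of_ne hi, Function.update_of_ne (fun h => hi (Fin.succ_injective _ h))]
      rw [htail, htail, listProd_ofFn_update_sub_smul (fun i : Fin (N + 1) => x i.succ) j y t, mul_sub, mul_smul_comm]
      congr 2
      rw [List.ofFn_succ (f := x ∘ j.succ.succAbove), List.prod_cons]
      simp only [Function.comp_apply, Fin.succ_succAbove_zero, Fin.succ_succAbove_succ]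
      rfl

end ShiftLemmas

section ShiftedFactors

/-- The `i`-th factor of the split-pair word with PAIR SHIFTS `d` (indexed like the pair annihilation letters): `u_i v_i − d_i` before the
insertion point, the lone `u_K`, `u_i v_{i-1} − d_{i-1}` after it. [folklore] -/
noncomputable def oneInsertionFactorShift (K n : ℕ) (hK : K ≤ n) (u : Fin (n + 1) → LinLetter ι) (v : Fin n → LinLetter ι)
    (d : Fin n → ℂ) (i : Fin (n + 1)) : Matrix (Finset ι) (Finset ι) ℂ :=
  if h : (i : ℕ) < K then
    linLetterOp (u i) * linLetterOp (v ⟨i, lt_of_lt_of_le h hK⟩) - d ⟨i, lt_of_lt_of_le h hK⟩ • (1 : Matrix (Finset ι) (Finset ι) ℂ)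
  else if h' : (i : ℕ) = K then linLetterOp (u i)
  else linLetterOp (u i) * linLetterOp (v ⟨(i : ℕ) - 1, by have := i.isLt; omega⟩) -
    d ⟨(i : ℕ) - 1, by have := i.isLt; omega⟩ • (1 : Matrix (Finset ι) (Finset ι) ℂ)

/-- Zero shifts give the unshifted factors. [cite: BenfattoGiulianiMastropietro2006, §2.1 (2.8)] -/
theorem oneInsertionFactorShift_zero (K n : ℕ) (hK : K ≤ n) (u : Fin (n + 1) → LinLetter ι) (v : Fin n → LinLetter ι)
    (i : Fin (n + 1)) : oneInsertionFactorShift K n hK u v 0 i = oneInsertionFactor K n hK u v i := by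
  unfold oneInsertionFactorShift oneInsertionFactor
  split_ifs <;> simp

/-- Updating the shift of pair `m` changes only the factor at the word position of pair `m`. [cite: BenfattoGiulianiMastropietro2006, §2.1 (2.8)] -/
theorem oneInsertionFactorShift_update (K n : ℕ) (hK : K ≤ n + 1) (u : Fin (n + 2) → LinLetter ι) (v : Fin (n + 1) → LinLetter ι)
    (d : Fin (n + 1) → ℂ) (m : Fin (n + 1)) (t : ℂ) :
    oneInsertionFactorShift K (n + 1) hK u v (Function.update d m t) =
      Function.update (oneInsertionFactorShift K (n + 1) hK u v (Function.update d m 0))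
        ((⟨K, Nat.lt_succ_of_le hK⟩ : Fin (n + 2)).succAbove m)
        (oneInsertionFactorShift K (n + 1) hK u v (Function.update d m 0) ((⟨K, Nat.lt_succ_of_le hK⟩ : Fin (n + 2)).succAbove m) -
          t • (1 : Matrix (Finset ι) (Finset ι) ℂ)) := by
  funext i
  have hp : (((⟨K, Nat.lt_succ_of_le hK⟩ : Fin (n + 2)).succAbove m : Fin (n + 2)) : ℕ) =
      (if (m : ℕ) < K then (m : ℕ) else (m : ℕ) + 1) := by
    split_ifs with hm
    · rw [Fin.succAbove_of_castSucc_lt _ _ (by rw [Fin.lt_def]; simpa using hm), Fin.val_castSucc]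
    · rw [Fin.succAbove_of_le_castSucc _ _ (by rw [Fin.le_def]; simpa using Nat.le_of_not_lt hm), Fin.val_succ]
  by_cases hi : i = (⟨K, Nat.lt_succ_of_le hK⟩ : Fin (n + 2)).succAbove m
  · subst hi
    rw [Function.update_self]
    unfold oneInsertionFactorShift
    by_cases hm : (m : ℕ) < K
    · have h1 : (((⟨K, Nat.lt_succ_of_le hK⟩ : Fin (n + 2)).succAbove m : Fin (n + 2)) : ℕ) < K := by rw [hp, if_pos hm]; exact hm
      rw [dif_pos h1, dif_pos h1]
      have hidx : (⟨(((⟨K, Nat.lt_succ_of_le hK⟩ : Fin (n + 2)).succAbove m : Fin (n + 2)) : ℕ), lt_of_lt_of_le h1 hK⟩ : Fin (n + 1)) = m :=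
        Fin.ext (by simp only [hp, if_pos hm])
      rw [hidx, Function.update_self, Function.update_self, zero_smul, sub_zero]
    · have h1 : ¬ (((⟨K, Nat.lt_succ_of_le hK⟩ : Fin (n + 2)).succAbove m : Fin (n + 2)) : ℕ) < K := by rw [hp, if_neg hm]; omega
      have h2 : ¬ (((⟨K, Nat.lt_succ_of_le hK⟩ : Fin (n + 2)).succAbove m : Fin (n + 2)) : ℕ) = K := by rw [hp, if_neg hm]; omega
      rw [dif_neg h1, dif_neg h2, dif_neg h1, dif_neg h2]
      have hidx : (⟨(((⟨K, Nat.lt_succ_of_le hK⟩ : Fin (n + 2)).succAbove m : Fin (n + 2)) : ℕ) - 1,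
          by have := (((⟨K, Nat.lt_succ_of_le hK⟩ : Fin (n + 2)).succAbove m)).isLt; omega⟩ : Fin (n + 1)) = m :=
        Fin.ext (by simp only [hp, if_neg hm]; omega)
      rw [hidx, Function.update_self, Function.update_self, zero_smul, sub_zero]
  · rw [Function.update_of_ne hi]
    -- position `i ≠ p`: its pair index is not `m`
    unfold oneInsertionFactorShift
    by_cases h1 : (i : ℕ) < K
    · rw [dif_pos h1, dif_pos h1]
      have hne : (⟨(i : ℕ), lt_of_lt_of_le h1 hK⟩ : Fin (n + 1)) ≠ m := by
        intro h
        apply hi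
        apply Fin.ext
        rw [hp, if_pos (by rw [← h]; exact h1), ← h]
      rw [Function.update_of_ne hne, Function.update_of_ne hne]
    · rw [dif_neg h1, dif_neg h1]
      by_cases h2 : (i : ℕ) = K
      · rw [dif_pos h2, dif_pos h2]
      · rw [dif_neg h2, dif_neg h2]
        have hne : (⟨(i : ℕ) - 1, by have := i.isLt; omega⟩ : Fin (n + 1)) ≠ m := by
          intro h
          apply hi
          apply Fin.ext
          have hmv : (m : ℕ) = (i : ℕ) - 1 := by rw [← h]
          rw [hp, hmv, if_neg (by omega)]
          omega
        rw [Function.update_of_ne hne, Function.update_of_ne hne]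

end ShiftedFactors

section Deletion

variable (K n : ℕ) (hK : K ≤ n + 1) (u : Fin (n + 2) → LinLetter ι) (v : Fin (n + 1) → LinLetter ι) (d : Fin (n + 1) → ℂ)
  (m : Fin (n + 1))

/-- The new insertion point after deleting pair `m`: `K − 1` if `m < K`, else `K`. [folklore] -/
private theorem val_predAbove_eq :
    ((m.predAbove (⟨K, Nat.lt_succ_of_le hK⟩ : Fin (n + 2)) : Fin (n + 1)) : ℕ) = (if (m : ℕ) < K then K - 1 else K) := by
  split_ifs with hm
  · rw [Fin.predAbove_of_castSucc_lt _ _ (by rw [Fin.lt_def]; simpa using hm), Fin.val_pred]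
  · rw [Fin.predAbove_of_le_castSucc _ _ (by rw [Fin.le_def]; simpa using Nat.le_of_not_lt hm), Fin.coe_castPred]

/-- The new insertion point is at most `n`. [folklore] -/
private theorem predAbove_le : ((m.predAbove (⟨K, Nat.lt_succ_of_le hK⟩ : Fin (n + 2)) : Fin (n + 1)) : ℕ) ≤ n := by
  have := (m.predAbove (⟨K, Nat.lt_succ_of_le hK⟩ : Fin (n + 2))).isLt; omega

/-- Generic value of `succAbove`. [folklore] -/
private theorem val_succAbove_ite {N : ℕ} (q : Fin (N + 1)) (k : Fin N) :
    ((q.succAbove k : Fin (N + 1)) : ℕ) = (if (k : ℕ) < q then (k : ℕ) else (k : ℕ) + 1) := by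
  split_ifs with hk
  · rw [Fin.succAbove_of_castSucc_lt _ _ (by rw [Fin.lt_def]; simpa using hk), Fin.val_castSucc]
  · rw [Fin.succAbove_of_le_castSucc _ _ (by rw [Fin.le_def]; simpa using Nat.le_of_not_lt hk), Fin.val_succ]

/-- **Deleting pair `m` from the split-pair word**: the factors at the remaining word positions (enumerated by `p.succAbove`, `p` the word
position of pair `m`) are the factors of the split-pair word of the remaining data, with insertion point `m.predAbove K`. [cite: BenfattoGiulianiMastropietro2006, §2.1 (2.8)] -/
theorem oneInsertionFactorShift_succAbove (k : Fin (n + 1)) :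
    oneInsertionFactorShift K (n + 1) hK u v d (((⟨K, Nat.lt_succ_of_le hK⟩ : Fin (n + 2)).succAbove m).succAbove k) =
      oneInsertionFactorShift ((m.predAbove (⟨K, Nat.lt_succ_of_le hK⟩ : Fin (n + 2)) : Fin (n + 1)) : ℕ) n
        (predAbove_le K n hK m)
        (u ∘ ((⟨K, Nat.lt_succ_of_le hK⟩ : Fin (n + 2)).succAbove m).succAbove) (v ∘ m.succAbove) (d ∘ m.succAbove) k := by
  set p : Fin (n + 2) := (⟨K, Nat.lt_succ_of_le hK⟩ : Fin (n + 2)).succAbove m with hpdef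
  have hp : ((p : Fin (n + 2)) : ℕ) = (if (m : ℕ) < K then (m : ℕ) else (m : ℕ) + 1) := by
    rw [hpdef, val_succAbove_ite]
  have hK' := val_predAbove_eq K n hK m
  have hpk := val_succAbove_ite p k
  -- index identities for the annihilation letters / shifts
  have hvidx : ∀ (a : ℕ) (ha : a < n + 1) (b : ℕ) (hb : b < n), (a = if b < (m : ℕ) then b else b + 1) →
      (⟨a, ha⟩ : Fin (n + 1)) = m.succAbove ⟨b, hb⟩ := by
    intro a ha b hb hab
    apply Fin.ext
    rw [val_succAbove_ite]
    simpa using hab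
  unfold oneInsertionFactorShift
  simp only [Function.comp_apply]
  by_cases h1 : ((p.succAbove k : Fin (n + 2)) : ℕ) < K
  · -- a pair before the insertion point, on both sides
    have h1' : (k : ℕ) < ((m.predAbove (⟨K, Nat.lt_succ_of_le hK⟩ : Fin (n + 2)) : Fin (n + 1)) : ℕ) := by
      rw [hK']; rw [hpk] at h1; split_ifs at h1 hp ⊢ <;> omega
    rw [dif_pos h1, dif_pos h1']
    have hidx := hvidx ((p.succAbove k : Fin (n + 2)) : ℕ) (lt_of_lt_of_le h1 hK) k (lt_of_lt_of_le h1' (predAbove_le K n hK m))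
      (by rw [hpk]; rw [hpk] at h1; split_ifs at h1 hp ⊢ <;> omega)
    rw [hidx]
  · rw [dif_neg h1]
    by_cases h2 : ((p.succAbove k : Fin (n + 2)) : ℕ) = K
    · have h1' : ¬ (k : ℕ) < ((m.predAbove (⟨K, Nat.lt_succ_of_le hK⟩ : Fin (n + 2)) : Fin (n + 1)) : ℕ) := by
        rw [hK']; rw [hpk] at h2; split_ifs at h2 hp ⊢ <;> omega
      have h2' : (k : ℕ) = ((m.predAbove (⟨K, Nat.lt_succ_of_le hK⟩ : Fin (n + 2)) : Fin (n + 1)) : ℕ) := by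
        rw [hK']; rw [hpk] at h2; split_ifs at h2 hp ⊢ <;> omega
      rw [dif_pos h2, dif_neg h1', dif_pos h2']
    · have h1' : ¬ (k : ℕ) < ((m.predAbove (⟨K, Nat.lt_succ_of_le hK⟩ : Fin (n + 2)) : Fin (n + 1)) : ℕ) := by
        rw [hK']; rw [hpk] at h1 h2; split_ifs at h1 h2 hp ⊢ <;> omega
      have h2' : ¬ (k : ℕ) = ((m.predAbove (⟨K, Nat.lt_succ_of_le hK⟩ : Fin (n + 2)) : Fin (n + 1)) : ℕ) := by
        rw [hK']; rw [hpk] at h1 h2; split_ifs at h1 h2 hp ⊢ <;> omega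
      rw [dif_neg h2, dif_neg h1', dif_neg h2']
      have hidx := hvidx (((p.succAbove k : Fin (n + 2)) : ℕ) - 1) (by have := (p.succAbove k).isLt; omega) ((k : ℕ) - 1)
        (by have := k.isLt; omega) (by rw [hpk]; rw [hpk] at h1 h2; split_ifs at h1 h2 hp ⊢ <;> omega)
      rw [hidx]

end Deletion

section MatrixDeletion

variable (β : ℝ) (h : Matrix ι ι ℂ) (K n : ℕ) (hK : K ≤ n + 1) (f g : Fin (n + 2) → ι → ℂ) (d : Fin (n + 1) → ℂ) (m : Fin (n + 1))

/-- The new insertion point as an element of `Fin (n+1)`. [folklore] -/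
private theorem mk_predAbove_eq :
    (⟨((m.predAbove (⟨K, Nat.lt_succ_of_le hK⟩ : Fin (n + 2)) : Fin (n + 1)) : ℕ),
      Nat.lt_succ_of_le (predAbove_le K n hK m)⟩ : Fin (n + 1)) = m.predAbove (⟨K, Nat.lt_succ_of_le hK⟩ : Fin (n + 2)) :=
  Fin.ext rfl

/-- **Deleting pair `m` from the split-pair matrix**: the principal submatrix of `splitPairMatrix − diagonal (0, d)` off row/column `m+1`
is the shifted split-pair matrix of the remaining data (insertion point `m.predAbove K`). [cite: BenfattoGiulianiMastropietro2006, §2.1 (2.8)] -/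
theorem splitPairMatrix_sub_diagonal_submatrix_succAbove :
    (splitPairMatrix β h K (n + 1) hK f g - Matrix.diagonal (Fin.cons 0 d : Fin (n + 2) → ℂ)).submatrix
        (Fin.succ m).succAbove (Fin.succ m).succAbove =
      splitPairMatrix β h ((m.predAbove (⟨K, Nat.lt_succ_of_le hK⟩ : Fin (n + 2)) : Fin (n + 1)) : ℕ) n (predAbove_le K n hK m)
          (f ∘ ((⟨K, Nat.lt_succ_of_le hK⟩ : Fin (n + 2)).succAbove m).succAbove) (g ∘ (Fin.succ m).succAbove) -
        Matrix.diagonal (Fin.cons 0 (d ∘ m.succAbove) : Fin (n + 1) → ℂ) := by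
  have hK' := val_predAbove_eq K n hK m
  have hcons : (Fin.cons 0 d : Fin (n + 2) → ℂ) ∘ (Fin.succ m).succAbove = (Fin.cons 0 (d ∘ m.succAbove) : Fin (n + 1) → ℂ) := by
    funext i
    induction i using Fin.cases with
    | zero => simp
    | succ i => simp [Fin.succ_succAbove_succ]
  rw [show ∀ (X D : Matrix (Fin (n + 2)) (Fin (n + 2)) ℂ), (X - D).submatrix (Fin.succ m).succAbove (Fin.succ m).succAbove =
      X.submatrix (Fin.succ m).succAbove (Fin.succ m).succAbove - D.submatrix (Fin.succ m).succAbove (Fin.succ m).succAbove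
      from fun X D => by ext; rfl,
    Matrix.submatrix_diagonal _ _ (Fin.succAbove_right_injective), hcons]
  congr 1
  ext a b
  simp only [Matrix.submatrix_apply]
  induction a using Fin.cases with
  | zero =>
    induction b using Fin.cases with
    | zero =>
      rw [Fin.succ_succAbove_zero, splitPairMatrix_zero_zero β h K (n + 1) hK f g, splitPairMatrix_zero_zero, Function.comp_apply,
        Function.comp_apply, Fin.succ_succAbove_zero, mk_predAbove_eq K n hK m, Fin.succAbove_succAbove_predAbove]
    | succ i =>
      rw [Fin.succ_succAbove_zero, Fin.succ_succAbove_succ, splitPairMatrix_zero_succ β h K (n + 1) hK f g, splitPairMatrix_zero_succ,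
        Function.comp_apply, Function.comp_apply, Fin.succ_succAbove_succ, mk_predAbove_eq K n hK m, Fin.succAbove_succAbove_predAbove]
      have hmi := val_succAbove_ite m i
      have hiff : K ≤ ((m.succAbove i : Fin (n + 1)) : ℕ) ↔
          ((m.predAbove (⟨K, Nat.lt_succ_of_le hK⟩ : Fin (n + 2)) : Fin (n + 1)) : ℕ) ≤ (i : ℕ) := by
        rw [hmi, hK']; split_ifs <;> omega
      by_cases hc : K ≤ ((m.succAbove i : Fin (n + 1)) : ℕ)
      · rw [if_pos hc, if_pos (hiff.1 hc)]
      · rw [if_neg hc, if_neg (fun h' => hc (hiff.2 h'))]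
  | succ i =>
    induction b using Fin.cases with
    | zero =>
      rw [Fin.succ_succAbove_zero, Fin.succ_succAbove_succ, splitPairMatrix_succ_zero β h K (n + 1) hK f g, splitPairMatrix_succ_zero,
        Function.comp_apply, Function.comp_apply, Fin.succ_succAbove_zero, mk_predAbove_eq K n hK m, Fin.succAbove_succAbove_succAbove_predAbove]
    | succ i' =>
      rw [Fin.succ_succAbove_succ, Fin.succ_succAbove_succ, splitPairMatrix_succ_succ β h K (n + 1) hK f g, splitPairMatrix_succ_succ,
        Function.comp_apply, Function.comp_apply, Fin.succ_succAbove_succ, mk_predAbove_eq K n hK m, Fin.succAbove_succAbove_succAbove_predAbove]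
      by_cases hc : i ≤ i'
      · rw [if_pos hc, if_pos (Fin.succAbove_le_succAbove_iff.2 hc)]
      · rw [if_neg hc, if_neg (fun h' => hc (Fin.succAbove_le_succAbove_iff.1 h'))]

end MatrixDeletion

section ShiftedTheorem

/-- **The SHIFTED (tadpole-subtracted) thermal Wick theorem for the split-pair word.**  For Hermitian `h`, real `β`, `K ≤ n`, creation data
`f` (word positions), annihilation data `g` (`g₀` leading, `g_{m+1}` pair `m`) and PAIR SHIFTS `d : Fin n → ℂ`:
`⟨c(g₀) · ∏_i (factor_i − d·1)⟩_{β,dΓ(h)} = −det (splitPairMatrix − diagonal (0, d₀, …, d_{n-1}))` — the counterterm sits on the diagonal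
of the pair block, the split pair carries none.  Proof: one pair at a time — both sides are affine in each `d_m`, with slopes the deleted
word / the principal minor, equal by induction on `n`. [cite: BenfattoGiulianiMastropietro2006, §2.1 (2.8)] -/
theorem gibbsState_dGamma_splitPairWordShift_eq_neg_det {h : Matrix ι ι ℂ} (hh : h.IsHermitian) (β : ℝ) :
    ∀ (n K : ℕ) (hK : K ≤ n) (f g : Fin (n + 1) → ι → ℂ) (d : Fin n → ℂ),
      gibbsState β (dGamma h)
          (linLetterOp (g 0, false) *
            (List.ofFn fun i : Fin (n + 1) =>
              oneInsertionFactorShift K n hK (fun a => (f a, true)) (Fin.tail fun b => (g b, false)) d i).prod) =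
        -(splitPairMatrix β h K n hK f g - Matrix.diagonal (Fin.cons 0 d : Fin (n + 1) → ℂ)).det
  | 0, K, hK, f, g, d => by
    have hd : d = 0 := funext fun i => i.elim0
    subst hd
    have h0 : (Fin.cons 0 (0 : Fin 0 → ℂ) : Fin 1 → ℂ) = 0 := by
      funext i
      induction i using Fin.cases with
      | zero => rfl
      | succ j => exact j.elim0
    have hdz : Matrix.diagonal (0 : Fin 1 → ℂ) = 0 := Matrix.diagonal_zero
    rw [h0, hdz, sub_zero]
    simp only [oneInsertionFactorShift_zero]
    exact gibbsState_dGamma_splitPairWord_eq_neg_det hh β K 0 hK f g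
  | n + 1, K, hK, f, g, d => by
    -- peel the shifts one pair at a time: the statement for shifts supported on the pairs `< j`
    suffices hP : ∀ j : ℕ, j ≤ n + 1 → ∀ d : Fin (n + 1) → ℂ, (∀ m : Fin (n + 1), j ≤ (m : ℕ) → d m = 0) →
        gibbsState β (dGamma h) (linLetterOp (g 0, false) * (List.ofFn fun i : Fin (n + 2) =>
          oneInsertionFactorShift K (n + 1) hK (fun a => (f a, true)) (Fin.tail fun b => (g b, false)) d i).prod) =
        -(splitPairMatrix β h K (n + 1) hK f g - Matrix.diagonal (Fin.cons 0 d : Fin (n + 2) → ℂ)).det from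
      hP (n + 1) le_rfl d (fun m hm => absurd m.isLt (by omega))
    intro j
    induction j with
    | zero =>
      intro _ d hd
      have hd0 : d = 0 := funext fun m => hd m (Nat.zero_le _)
      subst hd0
      have h0 : (Fin.cons 0 (0 : Fin (n + 1) → ℂ) : Fin (n + 2) → ℂ) = 0 := by
        funext i
        induction i using Fin.cases with
        | zero => rfl
        | succ i => rfl
      have hdz : Matrix.diagonal (0 : Fin (n + 2) → ℂ) = 0 := Matrix.diagonal_zero
      rw [h0, hdz, sub_zero]
      simp only [oneInsertionFactorShift_zero]
      exact gibbsState_dGamma_splitPairWord_eq_neg_det hh β K (n + 1) hK f g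
    | succ j ih =>
      intro hj d hd
      -- the pair whose shift is split off, and the shifts without it
      set mj : Fin (n + 1) := ⟨j, by omega⟩ with hmj
      set d' : Fin (n + 1) → ℂ := Function.update d mj 0 with hd'
      have hd'supp : ∀ m : Fin (n + 1), j ≤ (m : ℕ) → d' m = 0 := by
        intro m hm
        by_cases hmm : m = mj
        · rw [hmm, hd', Function.update_self]
        · rw [hd', Function.update_of_ne hmm]
          have : (m : ℕ) ≠ j := fun h' => hmm (Fin.ext (by rw [h', hmj]))
          exact hd m (by omega)
      have ih' := ih (by omega) d' hd'supp
      have hdd : d = Function.update d' mj (d mj) := by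
        rw [hd', Function.update_idem, Function.update_eq_self]
      have hd'0 : Function.update d' mj 0 = d' := by rw [hd', Function.update_idem]
      set Kf : Fin (n + 2) := ⟨K, Nat.lt_succ_of_le hK⟩ with hKf
      set p : Fin (n + 2) := Kf.succAbove mj with hp
      set u : Fin (n + 2) → LinLetter ι := fun a => (f a, true) with hu
      set v : Fin (n + 1) → LinLetter ι := Fin.tail fun b => (g b, false) with hv
      -- LHS: the word is affine in the shift of pair `mj`
      have hfac : oneInsertionFactorShift K (n + 1) hK u v d =
          Function.update (oneInsertionFactorShift K (n + 1) hK u v d') p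
            (oneInsertionFactorShift K (n + 1) hK u v d' p - d mj • (1 : Matrix (Finset ι) (Finset ι) ℂ)) := by
        conv_lhs => rw [hdd]
        rw [oneInsertionFactorShift_update, hd'0]
      have hLHS : (List.ofFn (oneInsertionFactorShift K (n + 1) hK u v d)).prod =
          (List.ofFn (oneInsertionFactorShift K (n + 1) hK u v d')).prod -
            d mj • (List.ofFn (oneInsertionFactorShift K (n + 1) hK u v d' ∘ p.succAbove)).prod := by
        rw [hfac, listProd_ofFn_update_sub_smul, Function.update_eq_self]
      -- the deleted word is the split-pair word of the remaining data
      have hdel : (oneInsertionFactorShift K (n + 1) hK u v d' ∘ p.succAbove) = fun k =>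
          oneInsertionFactorShift ((mj.predAbove Kf : Fin (n + 1)) : ℕ) n (predAbove_le K n hK mj)
            (fun a => (f (p.succAbove a), true)) (Fin.tail fun b => (g ((Fin.succ mj).succAbove b), false))
            (d' ∘ mj.succAbove) k := by
        funext k
        rw [Function.comp_apply, hp, oneInsertionFactorShift_succAbove]
        have huv : (v ∘ mj.succAbove) = Fin.tail fun b => (g ((Fin.succ mj).succAbove b), false) := by
          funext b
          simp only [hv, Fin.tail, Function.comp_apply, Fin.succ_succAbove_succ]
        rw [huv]
        rfl
      have ihn := gibbsState_dGamma_splitPairWordShift_eq_neg_det hh β n ((mj.predAbove Kf : Fin (n + 1)) : ℕ)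
        (predAbove_le K n hK mj) (f ∘ p.succAbove) (g ∘ (Fin.succ mj).succAbove) (d' ∘ mj.succAbove)
      simp only [Function.comp_apply, Fin.succ_succAbove_zero] at ihn
      -- RHS: the determinant is affine in the diagonal entry `(mj+1, mj+1)`
      have hX : splitPairMatrix β h K (n + 1) hK f g - Matrix.diagonal (Fin.cons 0 d : Fin (n + 2) → ℂ) =
          (splitPairMatrix β h K (n + 1) hK f g - Matrix.diagonal (Fin.cons 0 d' : Fin (n + 2) → ℂ)).updateRow mj.succ
            ((splitPairMatrix β h K (n + 1) hK f g - Matrix.diagonal (Fin.cons 0 d' : Fin (n + 2) → ℂ)) mj.succ -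
              d mj • Pi.single mj.succ 1) := by
        ext a b
        by_cases ha : a = mj.succ
        · subst ha
          rw [Matrix.updateRow_self]
          simp only [Matrix.sub_apply, Matrix.diagonal_apply, Pi.sub_apply, Pi.smul_apply, Pi.single_apply, Fin.cons_succ,
            smul_eq_mul]
          by_cases hb : mj.succ = b
          · subst hb
            rw [if_pos rfl, if_pos rfl, if_pos rfl, hd', Function.update_self]
            ring
          · rw [if_neg hb, if_neg hb, if_neg (fun h' => hb h'.symm)]
            ring
        · rw [Matrix.updateRow_ne ha]
          simp only [Matrix.sub_apply, Matrix.diagonal_apply]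
          by_cases hb : a = b
          · subst hb
            rw [if_pos rfl, if_pos rfl]
            induction a using Fin.cases with
            | zero => rfl
            | succ a =>
              simp only [Fin.cons_succ, hd']
              rw [Function.update_of_ne (fun h' => ha (by rw [h']))]
          · rw [if_neg hb, if_neg hb]
      -- assemble
      rw [hLHS, mul_sub, map_sub, mul_smul_comm, map_smul, hdel, ihn, ih', hX, det_updateRow_sub_smul_single,
        splitPairMatrix_sub_diagonal_submatrix_succAbove, smul_eq_mul]
      ring

end ShiftedTheorem

section BlockForm

/-- **Block form of the shifted split-pair Wick theorem** (the shape of the two-time Dyson coefficients): for `K` shifted pairs, the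
inserted creation letter, and `J` further shifted pairs,
`⟨c(g_Y) · ∏_{m<K}(c†(f₁m)c(g₁m) − d₁m) · c†(f_X) · ∏_{l<J}(c†(f₂l)c(g₂l) − d₂l)⟩_{β,dΓ(h)}
   = −det (splitPairMatrix β h K (K+J) (Fin.append f₁ (f_X, f₂)) (g_Y, Fin.append g₁ g₂) − diagonal (0, Fin.append d₁ d₂))`.
[cite: BenfattoGiulianiMastropietro2006, §2.1 (2.8)] -/
theorem gibbsState_dGamma_splitPairBlockWordShift_eq_neg_det {h : Matrix ι ι ℂ} (hh : h.IsHermitian) (β : ℝ) {K J : ℕ}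
    (f₁ g₁ : Fin K → ι → ℂ) (d₁ : Fin K → ℂ) (fX gY : ι → ℂ) (f₂ g₂ : Fin J → ι → ℂ) (d₂ : Fin J → ℂ) :
    gibbsState β (dGamma h)
        (linLetterOp (gY, false) *
          ((List.ofFn fun m : Fin K =>
              linLetterOp (f₁ m, true) * linLetterOp (g₁ m, false) - d₁ m • (1 : Matrix (Finset ι) (Finset ι) ℂ)).prod *
            linLetterOp (fX, true) *
            (List.ofFn fun l : Fin J =>
              linLetterOp (f₂ l, true) * linLetterOp (g₂ l, false) - d₂ l • (1 : Matrix (Finset ι) (Finset ι) ℂ)).prod)) =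
      -(splitPairMatrix β h K (K + J) (Nat.le_add_right K J)
            (Fin.append (m := K) (n := J + 1) f₁ (Fin.cons fX f₂ : Fin (J + 1) → ι → ℂ) : Fin (K + J + 1) → ι → ℂ)
            (Fin.cons gY (Fin.append g₁ g₂) : Fin (K + J + 1) → ι → ℂ) -
          Matrix.diagonal (Fin.cons 0 (Fin.append d₁ d₂) : Fin (K + J + 1) → ℂ)).det := by
  rw [← gibbsState_dGamma_splitPairWordShift_eq_neg_det hh β (K + J) K (Nat.le_add_right K J)]
  -- the factor function of the generic word is the block word, position by position
  have hF : (fun i : Fin (K + J + 1) => oneInsertionFactorShift K (K + J) (Nat.le_add_right K J)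
        (fun a => ((Fin.append (m := K) (n := J + 1) f₁ (Fin.cons fX f₂ : Fin (J + 1) → ι → ℂ) : Fin (K + J + 1) → ι → ℂ) a, true))
        (Fin.tail fun b => ((Fin.cons gY (Fin.append g₁ g₂) : Fin (K + J + 1) → ι → ℂ) b, false)) (Fin.append d₁ d₂) i) =
      (Fin.append (m := K) (n := J + 1) (fun m : Fin K =>
          linLetterOp (f₁ m, true) * linLetterOp (g₁ m, false) - d₁ m • (1 : Matrix (Finset ι) (Finset ι) ℂ))
        (Fin.cons (linLetterOp (fX, true)) (fun l : Fin J =>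
          linLetterOp (f₂ l, true) * linLetterOp (g₂ l, false) - d₂ l • (1 : Matrix (Finset ι) (Finset ι) ℂ)) :
            Fin (J + 1) → Matrix (Finset ι) (Finset ι) ℂ) : Fin (K + J + 1) → Matrix (Finset ι) (Finset ι) ℂ) := by
    funext i
    refine Fin.addCases (m := K) (n := J + 1) (fun i => ?_) (fun j => ?_) i
    · rw [Fin.append_left]
      unfold oneInsertionFactorShift
      have hi : ((Fin.castAdd (J + 1) i : Fin (K + J + 1)) : ℕ) < K := by simp
      rw [dif_pos hi]
      have h1 : (Fin.castAdd (J + 1) i : Fin (K + J + 1)) = Fin.castAdd (J + 1) i := rfl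
      have hidx : (⟨((Fin.castAdd (J + 1) i : Fin (K + J + 1)) : ℕ), lt_of_lt_of_le hi (Nat.le_add_right K J)⟩ : Fin (K + J)) =
          Fin.castAdd J i := Fin.ext (by simp)
      simp only [Fin.tail, hidx, Fin.cons_succ, Fin.append_left]
    · rw [Fin.append_right]
      induction j using Fin.cases with
      | zero =>
        unfold oneInsertionFactorShift
        have h1 : ¬ ((Fin.natAdd K (0 : Fin (J + 1)) : Fin (K + J + 1)) : ℕ) < K := by simp
        have h2 : ((Fin.natAdd K (0 : Fin (J + 1)) : Fin (K + J + 1)) : ℕ) = K := by simp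
        rw [dif_neg h1, dif_pos h2, Fin.cons_zero]
        simp only [Fin.append_right, Fin.cons_zero]
      | succ l =>
        unfold oneInsertionFactorShift
        have h1 : ¬ ((Fin.natAdd K (l.succ : Fin (J + 1)) : Fin (K + J + 1)) : ℕ) < K := by simp
        have h2 : ¬ ((Fin.natAdd K (l.succ : Fin (J + 1)) : Fin (K + J + 1)) : ℕ) = K := by simp
        rw [dif_neg h1, dif_neg h2, Fin.cons_succ]
        have hidx : (⟨((Fin.natAdd K (l.succ : Fin (J + 1)) : Fin (K + J + 1)) : ℕ) - 1,
            by have := (Fin.natAdd K (l.succ : Fin (J + 1)) : Fin (K + J + 1)).isLt; omega⟩ : Fin (K + J)) = Fin.natAdd K l :=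
          Fin.ext (by simp)
        simp only [Fin.tail, hidx, Fin.cons_succ, Fin.append_right]
  rw [hF, List.ofFn_fin_append, List.prod_append, List.ofFn_succ, List.prod_cons]
  simp only [Fin.cons_zero, Fin.cons_succ, Matrix.mul_assoc]

end BlockForm

end Literature.MathematicalPhysics.QuantumLattice
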